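import Mathlib
import Summits.ValiantsHypothesis.ValiantsHypothesis.Theorems.LacunarySymmetroidMatrixDescartesCensusWindowFourRowMult
import Summits.ValiantsHypothesis.ValiantsHypothesis.Theorems.LacunarySymmetroidMatrixDescartesCensusWindowFourWitnessMultRight

/-!
# `MatrixDescartes` census — the WINDOW-4 RIGHT ROW of a sharp fewnomial (multiplicity form)

HONEST FRAMING.  Object-search cell `pub-symmetroid`, door-A target `DoorA26 := PosRootLawAt 2 6 19`
(stmt-ValiantsHypothesis-19979; OPEN, typed, never asserted).  Mirror of `…CensusWindowFourRowMult` (engine-2 g30) for the RIGHT witness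
family `(μ, t)` of val-sym-door-p1 g9 (p571759), via the multiplicity form `fourNomial_countP_posRoots_le_two_of_right_param`
(`…CensusWindowFourWitnessMultRight`).  For a sharp `n`-nomial (`n − 1` positive roots with multiplicity), positions `r < s < u < v`,
gaps `U₁, V, W`, `S = U₁+V+W`, absolute twist multipliers `M_t`, `A, B, Cc, E = |c_t|·M_t`, and every `μ ≥ 1`, `t > 0` with
`μ(U₁+V) + t·S < S` (`window_four_right_row_of_sharp`):
  `(U₁B)^W ((V+W)S·E)^V ≤ ((U₁+V)Cc)^W (μV(U₁+V)Cc)^V`  ∨  `(tV·Cc)^W (μV(U₁+V)Cc)^(U₁+V) < (U₁A)^W ((V+W)S·E)^(U₁+V)`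
— two monomial inequalities, i.e. the two-way log-linear split of hybrid32's RIGHT point cut.  Nothing here bounds any census count;
`DoorA26` OPEN; nothing on `MatrixDescartes` (stmt-ValiantsHypothesis-18050) or `VP ≠ VNP`.

[folklore] Rolle with multiplicity (Euler twists) + the window-4 witness; no single source.
-/

-- `Summit.ValiantsHypothesis.ValiantsHypothesis.…` repeats a component by the D-0017 layout
-- (single-conjunct summit), which the `dupNamespace` linter flags; the name is mandated.
set_option linter.dupNamespace false

namespace Summit.ValiantsHypothesis.ValiantsHypothesis.Theorems.LacunarySymmetroidMatrixDescartes.Census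

open Polynomial Finset
open scoped BigOperators Polynomial

/-- **Core of the window-4 right row** (pure form): an alternating 4-nomial `κr X^er + κs X^es + κu X^eu + κv X^ev` (consecutive
coefficients of opposite signs, gaps `U₁, V, W ≥ 1`) with at least three positive roots counted with multiplicity satisfies, for every
`μ ≥ 1`, `t > 0` with `μ(U₁+V) + t(U₁+V+W) < U₁+V+W`, one of the two negated right-witness monomial inequalities. [folklore] -/
theorem window_four_right_row_core {κr κs κu κv : ℝ} {er es eu ev U₁ V W : ℕ}
    (hU₁ : er + U₁ = es) (hV : es + V = eu) (hW : eu + W = ev) (hU₁0 : 0 < U₁) (hV0 : 0 < V) (hW0 : 0 < W)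
    (h3 : 3 ≤ ((C κr * X ^ er + C κs * X ^ es + C κu * X ^ eu + C κv * X ^ ev : ℝ[X]).roots.countP (fun x => 0 < x)))
    (hsg1 : κr * κs < 0) (hsg2 : κs * κu < 0) (hsg3 : κu * κv < 0) (mu t : ℝ) (hmu : 1 ≤ mu) (ht : 0 < t)
    (hmut : mu * ((U₁ : ℝ) + V) + t * ((U₁ : ℝ) + V + W) < (U₁ : ℝ) + V + W) :
    ((U₁ : ℝ) * |κs|) ^ W * (((V : ℝ) + W) * ((U₁ : ℝ) + V + W) * |κv|) ^ V
        ≤ (((U₁ : ℝ) + V) * |κu|) ^ W * (mu * ((V : ℝ) * ((U₁ : ℝ) + V) * |κu|)) ^ V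
    ∨ (t * ((V : ℝ) * |κu|)) ^ W * (mu * ((V : ℝ) * ((U₁ : ℝ) + V) * |κu|)) ^ (U₁ + V)
        < ((U₁ : ℝ) * |κr|) ^ W * (((V : ℝ) + W) * ((U₁ : ℝ) + V + W) * |κv|) ^ (U₁ + V) := by
  have hκr0 : κr ≠ 0 := by intro h; rw [h, zero_mul] at hsg1; exact lt_irrefl 0 hsg1
  have hκs0 : κs ≠ 0 := by intro h; rw [h, mul_zero] at hsg1; exact lt_irrefl 0 hsg1
  have hκu0 : κu ≠ 0 := by intro h; rw [h, mul_zero] at hsg2; exact lt_irrefl 0 hsg2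
  have hκv0 : κv ≠ 0 := by intro h; rw [h, mul_zero] at hsg3; exact lt_irrefl 0 hsg3
  have hAp : 0 < |κr| := abs_pos.mpr hκr0
  have hBp : 0 < |κs| := abs_pos.mpr hκs0
  have hCp : 0 < |κu| := abs_pos.mpr hκu0
  have hEp : 0 < |κv| := abs_pos.mpr hκv0
  obtain ⟨σ, hσ0, hσr, hσs, hσu, hσv⟩ : ∃ σ : ℝ, σ ≠ 0 ∧ κr = σ * |κr| ∧ κs = -(σ * |κs|) ∧ κu = σ * |κu| ∧ κv = -(σ * |κv|) := by
    rcases lt_or_gt_of_ne hκr0 with hr | hr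
    · have hs : 0 < κs := by nlinarith
      have hu : κu < 0 := by nlinarith
      have hv : 0 < κv := by nlinarith
      refine ⟨-1, by norm_num, ?_, ?_, ?_, ?_⟩
      · rw [abs_of_neg hr]; ring
      · rw [abs_of_pos hs]; ring
      · rw [abs_of_neg hu]; ring
      · rw [abs_of_pos hv]; ring
    · have hs : κs < 0 := by nlinarith
      have hu : 0 < κu := by nlinarith
      have hv : κv < 0 := by nlinarith
      refine ⟨1, by norm_num, ?_, ?_, ?_, ?_⟩
      · rw [abs_of_pos hr]; ring
      · rw [abs_of_neg hs]; ring
      · rw [abs_of_pos hu]; ring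
      · rw [abs_of_neg hv]; ring
  set g : ℝ[X] := C |κr| - C |κs| * X ^ U₁ + C |κu| * X ^ (U₁ + V) - C |κv| * X ^ (U₁ + V + W) with hgdef
  have hes : es = er + U₁ := hU₁.symm
  have heu : eu = er + (U₁ + V) := by omega
  have hev : ev = er + (U₁ + V + W) := by omega
  have hfac' : (C (σ * |κr|) * X ^ er + C (-(σ * |κs|)) * X ^ es + C (σ * |κu|) * X ^ eu + C (-(σ * |κv|)) * X ^ ev : ℝ[X])
      = C σ * X ^ er * g := by
    rw [hgdef, hes, heu, hev]
    simp only [map_neg, map_mul, pow_add]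
    ring
  have hfac : (C κr * X ^ er + C κs * X ^ es + C κu * X ^ eu + C κv * X ^ ev : ℝ[X]) = C σ * X ^ er * g := by
    rw [← hfac', ← hσr, ← hσs, ← hσu, ← hσv]
  have hg0 : g ≠ 0 := by
    intro h0
    have := congrArg (fun q : ℝ[X] => q.coeff 0) h0
    simp only [hgdef, coeff_sub, coeff_add, coeff_C_zero, coeff_C_mul, coeff_X_pow, coeff_zero] at this
    have h1 : (0 : ℕ) ≠ U₁ := by omega
    have h2 : (0 : ℕ) ≠ U₁ + V := by omega
    have h3' : (0 : ℕ) ≠ U₁ + V + W := by omega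
    simp only [h1, h2, h3', if_false, mul_zero, sub_zero, add_zero] at this
    exact hAp.ne' this
  have h3g : 3 ≤ g.roots.countP (fun x => 0 < x) := by
    rw [← countP_posRoots_C_mul_X_pow_mul hσ0 er hg0, ← hfac]; exact h3
  by_contra hnot
  push Not at hnot
  obtain ⟨hD2, hD3⟩ := hnot
  -- ρ = μ V (U₁+V) Cc / ((V+W) S E)
  have hden : 0 < ((V : ℝ) + W) * ((U₁ : ℝ) + V + W) * |κv| := by positivity
  obtain ⟨ρ, hρdef'⟩ : ∃ ρ : ℝ, ρ = mu * ((V : ℝ) * ((U₁ : ℝ) + V) * |κu|) / (((V : ℝ) + W) * ((U₁ : ℝ) + V + W) * |κv|) := ⟨_, rfl⟩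
  have hmu0 : 0 < mu := by linarith
  have hρ : 0 < ρ := by rw [hρdef']; positivity
  have hρdef : ρ * (((V : ℝ) + W) * ((U₁ : ℝ) + V + W) * |κv|) = mu * ((V : ℝ) * ((U₁ : ℝ) + V) * |κu|) := by
    rw [hρdef']; field_simp
  have hρV : ρ ^ V * (((V : ℝ) + W) * ((U₁ : ℝ) + V + W) * |κv|) ^ V = (mu * ((V : ℝ) * ((U₁ : ℝ) + V) * |κu|)) ^ V := by
    rw [← mul_pow, hρdef]
  have hρUV : ρ ^ (U₁ + V) * (((V : ℝ) + W) * ((U₁ : ℝ) + V + W) * |κv|) ^ (U₁ + V)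
      = (mu * ((V : ℝ) * ((U₁ : ℝ) + V) * |κu|)) ^ (U₁ + V) := by
    rw [← mul_pow, hρdef]
  have hdV : 0 < (((V : ℝ) + W) * ((U₁ : ℝ) + V + W) * |κv|) ^ V := pow_pos hden V
  have hdUV : 0 < (((V : ℝ) + W) * ((U₁ : ℝ) + V + W) * |κv|) ^ (U₁ + V) := pow_pos hden (U₁ + V)
  -- h2 : ((U₁+V) Cc)^W ρ^V < (U₁ B)^W
  have h2 : (((U₁ : ℝ) + V) * |κu|) ^ W * ρ ^ V < ((U₁ : ℝ) * |κs|) ^ W := by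
    have key : ((((U₁ : ℝ) + V) * |κu|) ^ W * ρ ^ V) * (((V : ℝ) + W) * ((U₁ : ℝ) + V + W) * |κv|) ^ V
        < ((U₁ : ℝ) * |κs|) ^ W * (((V : ℝ) + W) * ((U₁ : ℝ) + V + W) * |κv|) ^ V := by
      have heq : ((((U₁ : ℝ) + V) * |κu|) ^ W * ρ ^ V) * (((V : ℝ) + W) * ((U₁ : ℝ) + V + W) * |κv|) ^ V
          = (((U₁ : ℝ) + V) * |κu|) ^ W * (mu * ((V : ℝ) * ((U₁ : ℝ) + V) * |κu|)) ^ V := by rw [← hρV]; ring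
      rw [heq]; exact hD2
    exact lt_of_mul_lt_mul_right key hdV.le
  -- h3 : (U₁ A)^W ≤ (t V Cc)^W ρ^(U₁+V)
  have h3' : ((U₁ : ℝ) * |κr|) ^ W ≤ (t * ((V : ℝ) * |κu|)) ^ W * ρ ^ (U₁ + V) := by
    have key : ((U₁ : ℝ) * |κr|) ^ W * (((V : ℝ) + W) * ((U₁ : ℝ) + V + W) * |κv|) ^ (U₁ + V)
        ≤ ((t * ((V : ℝ) * |κu|)) ^ W * ρ ^ (U₁ + V)) * (((V : ℝ) + W) * ((U₁ : ℝ) + V + W) * |κv|) ^ (U₁ + V) := by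
      have heq : ((t * ((V : ℝ) * |κu|)) ^ W * ρ ^ (U₁ + V)) * (((V : ℝ) + W) * ((U₁ : ℝ) + V + W) * |κv|) ^ (U₁ + V)
          = (t * ((V : ℝ) * |κu|)) ^ W * (mu * ((V : ℝ) * ((U₁ : ℝ) + V) * |κu|)) ^ (U₁ + V) := by rw [← hρUV]; ring
      rw [heq]; exact hD3
    exact le_of_mul_le_mul_right key hdUV
  have hle2 := fourNomial_countP_posRoots_le_two_of_right_param hU₁0 hV0 hW0 hAp hBp hCp hEp hmu ht hmut hρ hρdef h2 h3'
  have hle2' : g.roots.countP (fun x => 0 < x) ≤ 2 := by rw [hgdef]; exact hle2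
  omega

/-- **WINDOW-4 RIGHT ROW OF A SHARP FEWNOMIAL (multiplicative form).**  Under the hypotheses of `window_four_countP_of_sharp`, with the
gaps `U₁, V, W`, the absolute twist multipliers `M_t` supplied as hypotheses, `A, B, Cc, E = |c_t|·M_t`, and parameters `μ ≥ 1`, `t > 0`
with `μ(U₁+V) + t(U₁+V+W) < U₁+V+W`: one of the two negated right-witness monomial inequalities holds. [folklore] -/
theorem window_four_right_row_of_sharp {n : ℕ} {e : ℕ → ℕ} {c : ℕ → ℝ} (he : ∀ i j, i < j → j < n → e i < e j)
    (hZ : n ≤ (∑ t ∈ range n, C (c t) * X ^ (e t) : ℝ[X]).roots.countP (fun x => 0 < x) + 1)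
    {r s u v : ℕ} (hrs : r < s) (hsu : s < u) (huv : u < v) (hvn : v < n)
    (U₁ V W : ℕ) (hU₁ : e r + U₁ = e s) (hV : e s + V = e u) (hW : e u + W = e v)
    (Mr Ms Mu Mv : ℝ)
    (hMr : |∏ w ∈ (range n).filter (fun w => ¬(w = r ∨ w = s ∨ w = u ∨ w = v)), ((e r : ℝ) - e w)| = Mr)
    (hMs : |∏ w ∈ (range n).filter (fun w => ¬(w = r ∨ w = s ∨ w = u ∨ w = v)), ((e s : ℝ) - e w)| = Ms)
    (hMu : |∏ w ∈ (range n).filter (fun w => ¬(w = r ∨ w = s ∨ w = u ∨ w = v)), ((e u : ℝ) - e w)| = Mu)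
    (hMv : |∏ w ∈ (range n).filter (fun w => ¬(w = r ∨ w = s ∨ w = u ∨ w = v)), ((e v : ℝ) - e w)| = Mv)
    (mu t : ℝ) (hmu : 1 ≤ mu) (ht : 0 < t) (hmut : mu * ((U₁ : ℝ) + V) + t * ((U₁ : ℝ) + V + W) < (U₁ : ℝ) + V + W) :
    ((U₁ : ℝ) * (|c s| * Ms)) ^ W * (((V : ℝ) + W) * ((U₁ : ℝ) + V + W) * (|c v| * Mv)) ^ V
        ≤ (((U₁ : ℝ) + V) * (|c u| * Mu)) ^ W * (mu * ((V : ℝ) * ((U₁ : ℝ) + V) * (|c u| * Mu))) ^ V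
    ∨ (t * ((V : ℝ) * (|c u| * Mu))) ^ W * (mu * ((V : ℝ) * ((U₁ : ℝ) + V) * (|c u| * Mu))) ^ (U₁ + V)
        < ((U₁ : ℝ) * (|c r| * Mr)) ^ W * (((V : ℝ) + W) * ((U₁ : ℝ) + V + W) * (|c v| * Mv)) ^ (U₁ + V) := by
  have hU₁0 : 0 < U₁ := by have := he r s hrs (by omega); omega
  have hV0 : 0 < V := by have := he s u hsu (by omega); omega
  have hW0 : 0 < W := by have := he u v huv hvn; omega
  obtain ⟨h3, hsg1, hsg2, hsg3⟩ := window_four_countP_of_sharp he hZ hrs hsu huv hvn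
  rw [← hMr, ← hMs, ← hMu, ← hMv]
  simp only [← abs_mul]
  exact window_four_right_row_core hU₁ hV hW hU₁0 hV0 hW0 h3 hsg1 hsg2 hsg3 mu t hmu ht hmut

end Summit.ValiantsHypothesis.ValiantsHypothesis.Theorems.LacunarySymmetroidMatrixDescartes.Census
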